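import Literature.NumberTheory.LFunctions.WeilWindowCertifiedProfile
import HarnessLib

/-!
# The certified margin floor of the Weil cluster's resurrection rung (cell rh-split, PRICE-WFIN-RESURRECTION, P1)

RH-FREE bookkeeping, CONDITIONAL on the named fact `Chuk2026_table1` (Chuk 2026 Table 1, preprint; replicated by the
cell's screen S-C14-4-2): for every window `H ≥ 2` the even-sector ground energy of Weil's quadratic form satisfies
`ε_ev(H) ≤ 3.19·10⁻²⁸³`, hence so does the full ground energy `ε(H) = min(ε_ev, ε_od)`. Any lower-bound certificate of
`WeilPositivityOn H`, `H ≥ 2`, must therefore carry its whole error budget below `3.19·10⁻²⁸³ · ‖f‖₂²`.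
Typer-ready snippet (eng-4 g2); nothing here bears on the truth of RH.
-/

noncomputable section

namespace Literature.NumberTheory.LFunctions

/-- **Margin floor, even sector**: `Chuk2026_table1 → 2 ≤ H → ε_ev(H) ≤ 3.19·10⁻²⁸³`
(row `(2.0, 3.19e-283)` of Table 1 and antitonicity of `ε_ev`, Bombieri Thm 5).
[cite: Chuk2026WeilWindows, Table 1] -/
theorem weilEvenGroundEnergy_le_of_two_le (h : Chuk2026_table1) {H : ℝ} (hH : 2 ≤ H) :
    weilEvenGroundEnergy H ≤ (3.19e-283 : ℝ) := by
  have h2 : weilEvenGroundEnergy (2.0 : ℝ) ≤ (3.19e-283 : ℝ) := h (2.0, 3.19e-283) (by simp [chuk2026Table1])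
  have h20 : (2.0 : ℝ) = 2 := by norm_num
  rw [h20] at h2
  exact (weilEvenGroundEnergy_antitone (by norm_num : (0 : ℝ) < 2) hH).trans h2

/-- **Margin floor, full ground energy**: `Chuk2026_table1 → 2 ≤ H → ε(H) ≤ 3.19·10⁻²⁸³`
(`ε ≤ ε_ev`, `weilGroundEnergy_le_weilEvenGroundEnergy`). [cite: Chuk2026WeilWindows, Table 1] -/
theorem weilGroundEnergy_le_of_two_le (h : Chuk2026_table1) {H : ℝ} (hH : 2 ≤ H) :
    weilGroundEnergy H ≤ (3.19e-283 : ℝ) :=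
  (weilGroundEnergy_le_weilEvenGroundEnergy H).trans (weilEvenGroundEnergy_le_of_two_le h hH)

end Literature.NumberTheory.LFunctions
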